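import Summits.QuantumFields.YangMills.Theorems.BalabanLadderIRPinnedExitRateForm
import HarnessLib

/-!
# Crux `BalabanLadder.IR` ∕ `IRcof` (stmt-QuantumFields-19354 ∕ 26930): the two slots of record are `∀ᶠ` versus `∃ᶠ` of ONE predicate —
# «the cold `4:1` box of physical side `T` is 96 %-pure at coupling `β`» (helper; LEAD prover ym-ir-line-ab-p1 gen 7, slot custody; def-free)

HONEST STATUS.  Filter-language corollaries of the landed designated-box forms (`BalabanLadderIRPinnedExitRateForm`, p658673); nothing here proves
PX(1/24), PXcof(1/24) (THE NUMBER), `BalabanLadder.IR` (19354), `IRcof` (26930), or the Clay Yang–Mills mass gap (NOT proved anywhere in this tree;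
R4 = the conditional finite-𝕋⁴ rung `BalabanLadder.UV` only).  Width 0 toward the stubs.

With `Pure T β :≡ coldDefect r.ρ β ⌈T/a(β)⌉₊ ≤ 1/24` (the ONE box of physical side `T` at coupling `β`; not a definition, spelled inline):

* `pinnedExitAt24_iff_eventually` — **PX(1/24) (19354 slot) ↔ `∃ T > 0, ∀ᶠ β in atTop, Pure T β`**;
* `pinnedExitsCofinalAt24_iff_frequently` — **PXcof(1/24) (26930 slot, body verbatim) ↔ `∃ T > 0, ∃ᶠ β in atTop, Pure T β`**;
* `pinnedExitsCofinal_of_pinnedExit_filter` — the supplier direction PX ⇒ PXcof is `Eventually.frequently` (re-derivation of the landed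
  `PinnedExitCofinal.pinnedExitsCofinal_of_pinnedExitAt` through the filter faces; `atTop` on `ℝ` is `NeBot`).

READING.  The item of record (19354) and the re-typed leaf (26930) carry, on the simply-connected half, the SAME one-box predicate; they differ by
exactly one quantifier: EVENTUALLY versus FREQUENTLY in the coupling.  A refuter of PXcof must make the box of EVERY fixed physical side impure at ALL
large couplings; a refuter of PX only along SOME sequence `β_k → ∞`.

References: tree `BalabanLadderIRPinnedExitRateForm` (LEAD g7), `BalabanLadderIRPinnedExit96`, `BalabanLadderIRPinnedExitCofinal`; Mathlib `Filter.eventually_atTop`,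
`Filter.frequently_atTop`.
-/

noncomputable section

open Filter Topology
open Literature.MathematicalPhysics.QuantumFieldTheory
open Summit.QuantumFields.YangMills.Cruxes.OSLegsFromFemtoAndGap.DlrCollarTransfer (LowerBounds)
open Summit.QuantumFields.YangMills.Cruxes.IR.ColdPurityBridge (coldDefect)
open Summit.QuantumFields.YangMills.Cruxes.IR.PinnedExit96 (PinnedExitAt)

namespace Summit.QuantumFields.YangMills.Cruxes.IR.PinnedExit96.RateForm

/-- **PX(1/24) ↔ `∃ T > 0, ∀ᶠ β in atTop, δᶜ_β(⌈T/a(β)⌉₊) ≤ 1/24` (PROVED)** — the 19354 slot token is «EVENTUALLY in the coupling, the cold `4:1` box of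
physical side `T` is 96 %-pure». -/
theorem pinnedExitAt24_iff_eventually :
    PinnedExitAt (1 / 24) ↔
    ∀ (G : Type) [Group G] [TopologicalSpace G] [IsTopologicalGroup G] [CompactSpace G],
      IsCompactSimpleLieGroup G → SimplyConnectedSpace G →
      letI : MeasurableSpace G := borel G
      haveI : BorelSpace G := ⟨rfl⟩
      ∀ (r : LatticeRep G) (a : ℝ → ℝ), (∀ β, 0 < a β) → Tendsto a atTop (𝓝 0) → LowerBounds G r a →
        ∃ T : ℝ, 0 < T ∧ ∀ᶠ β : ℝ in atTop, coldDefect r.ρ β ⌈T / a β⌉₊ ≤ 1 / 24 := by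
  rw [pinnedExitAt24_iff_designated]
  constructor
  · intro h G _ _ _ _ hG hsc
    letI : MeasurableSpace G := borel G
    haveI : BorelSpace G := ⟨rfl⟩
    intro r a ha ha0 hlb
    obtain ⟨T, β₁, hT, hdes⟩ := h G hG hsc r a ha ha0 hlb
    exact ⟨T, hT, Filter.eventually_atTop.2 ⟨β₁, hdes⟩⟩
  · intro h G _ _ _ _ hG hsc
    letI : MeasurableSpace G := borel G
    haveI : BorelSpace G := ⟨rfl⟩
    intro r a ha ha0 hlb
    obtain ⟨T, hT, hev⟩ := h G hG hsc r a ha ha0 hlb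
    obtain ⟨β₁, hdes⟩ := Filter.eventually_atTop.1 hev
    exact ⟨T, β₁, hT, hdes⟩

/-- **PXcof(1/24) ↔ `∃ T > 0, ∃ᶠ β in atTop, δᶜ_β(⌈T/a(β)⌉₊) ≤ 1/24` (PROVED)** — the 26930 slot token (cofinal body spelled verbatim) is «FREQUENTLY in the
coupling, the cold `4:1` box of physical side `T` is 96 %-pure». -/
theorem pinnedExitsCofinalAt24_iff_frequently :
    (∀ (G : Type) [Group G] [TopologicalSpace G] [IsTopologicalGroup G] [CompactSpace G],
      IsCompactSimpleLieGroup G → SimplyConnectedSpace G →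
      letI : MeasurableSpace G := borel G
      haveI : BorelSpace G := ⟨rfl⟩
      ∀ (r : LatticeRep G) (a : ℝ → ℝ), (∀ β, 0 < a β) → Tendsto a atTop (𝓝 0) → LowerBounds G r a →
        ∃ T : ℝ, ∀ β₁ : ℝ, ∃ β : ℝ, β₁ ≤ β ∧ ∃ L : ℕ, 8 ≤ L ∧ a β * (L : ℝ) ≤ T ∧ coldDefect r.ρ β L ≤ 1 / 24) ↔
    ∀ (G : Type) [Group G] [TopologicalSpace G] [IsTopologicalGroup G] [CompactSpace G],
      IsCompactSimpleLieGroup G → SimplyConnectedSpace G →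
      letI : MeasurableSpace G := borel G
      haveI : BorelSpace G := ⟨rfl⟩
      ∀ (r : LatticeRep G) (a : ℝ → ℝ), (∀ β, 0 < a β) → Tendsto a atTop (𝓝 0) → LowerBounds G r a →
        ∃ T : ℝ, 0 < T ∧ ∃ᶠ β : ℝ in atTop, coldDefect r.ρ β ⌈T / a β⌉₊ ≤ 1 / 24 := by
  rw [pinnedExitsCofinalAt24_iff_designated]
  constructor
  · intro h G _ _ _ _ hG hsc
    letI : MeasurableSpace G := borel G
    haveI : BorelSpace G := ⟨rfl⟩
    intro r a ha ha0 hlb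
    obtain ⟨T, hT, hdes⟩ := h G hG hsc r a ha ha0 hlb
    exact ⟨T, hT, Filter.frequently_atTop.2 hdes⟩
  · intro h G _ _ _ _ hG hsc
    letI : MeasurableSpace G := borel G
    haveI : BorelSpace G := ⟨rfl⟩
    intro r a ha ha0 hlb
    obtain ⟨T, hT, hfr⟩ := h G hG hsc r a ha ha0 hlb
    exact ⟨T, hT, Filter.frequently_atTop.1 hfr⟩

/-- **PX(1/24) ⇒ PXcof(1/24) through the filter faces (PROVED)**: `Eventually.frequently` on `atTop : Filter ℝ` (re-derivation of the landed supplier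
direction `PinnedExitCofinal.pinnedExitsCofinal_of_pinnedExitAt`). -/
theorem pinnedExitsCofinal_of_pinnedExit_filter (hP : PinnedExitAt (1 / 24)) :
    ∀ (G : Type) [Group G] [TopologicalSpace G] [IsTopologicalGroup G] [CompactSpace G],
      IsCompactSimpleLieGroup G → SimplyConnectedSpace G →
      letI : MeasurableSpace G := borel G
      haveI : BorelSpace G := ⟨rfl⟩
      ∀ (r : LatticeRep G) (a : ℝ → ℝ), (∀ β, 0 < a β) → Tendsto a atTop (𝓝 0) → LowerBounds G r a →
        ∃ T : ℝ, ∀ β₁ : ℝ, ∃ β : ℝ, β₁ ≤ β ∧ ∃ L : ℕ, 8 ≤ L ∧ a β * (L : ℝ) ≤ T ∧ coldDefect r.ρ β L ≤ 1 / 24 := by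
  rw [pinnedExitsCofinalAt24_iff_frequently]
  intro G _ _ _ _ hG hsc
  letI : MeasurableSpace G := borel G
  haveI : BorelSpace G := ⟨rfl⟩
  intro r a ha ha0 hlb
  obtain ⟨T, hT, hev⟩ := pinnedExitAt24_iff_eventually.1 hP G hG hsc r a ha ha0 hlb
  exact ⟨T, hT, hev.frequently⟩

end Summit.QuantumFields.YangMills.Cruxes.IR.PinnedExit96.RateForm

end
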